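import Mathlib.RingTheory.KrullDimension.Basic
import Mathlib.RingTheory.Ideal.Maps
import Mathlib.Algebra.Ring.Equiv
import HarnessLib

/-!
# Ring-isomorphism invariance of the F-rational stalk clause (crux `FrobeniusLadder.FRationalResolution`, line `Sketch`)

Stub `stub_clause_of_ringEquiv` of the skeleton `Sketch` for crux stmt-ResolutionOfSingularities-15317.
The crux's inline per-stalk hypothesis reads: "`R` is a domain, and for every `d = dim R` and every
`s : Fin d → R` generating an ideal with maximal radical (a system of parameters), the ideal `(s)` is
tightly closed: `c ≠ 0` and `c · y^(p^e) ∈ span {z^(p^e) | z ∈ (s)}` for all `e` force `y ∈ (s)`".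
This clause transports along a ring isomorphism `φ : R ≃+* S`: pure commutative algebra — pull every
ingredient (`s`, `y`, `c`, the Frobenius-power spans) back along `φ.symm`, apply the clause in `R`,
and push the conclusion forward with `φ`.
-/

set_option linter.dupNamespace false

namespace Summit.ResolutionOfSingularities.ResolutionOfSingularities.Theorems.FRationalResolution.ClauseInvariance

/-- The ideal generated by the pulled-back tuple `φ.symm ∘ s` is the preimage under `φ` of the ideal
generated by `s`. -/
theorem span_range_symm_comp {R S : Type} [CommRing R] [CommRing S] (φ : R ≃+* S) {d : ℕ}
    (s : Fin d → S) :
    Ideal.span (Set.range (φ.symm ∘ s)) = (Ideal.span (Set.range s)).comap φ := by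
  rw [Set.range_comp, ← Ideal.map_span, Ideal.map_symm]

/-- Pulling a tight-closure membership test back along a ring isomorphism: if
`c * y ^ p ^ e ∈ span ((· ^ p ^ e) '' I)` in `S`, then
`φ.symm c * (φ.symm y) ^ p ^ e ∈ span ((· ^ p ^ e) '' (I.comap φ))` in `R`. -/
theorem symm_mem_span_pow_image {R S : Type} [CommRing R] [CommRing S] (φ : R ≃+* S) (p e : ℕ)
    (I : Ideal S) {y c : S}
    (hmem : c * y ^ p ^ e ∈ Ideal.span ((fun z : S => z ^ p ^ e) '' (I : Set S))) :
    φ.symm c * φ.symm y ^ p ^ e ∈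
      Ideal.span ((fun z : R => z ^ p ^ e) '' (I.comap φ : Set R)) := by
  have h1 : φ.symm (c * y ^ p ^ e) ∈
      (Ideal.span ((fun z : S => z ^ p ^ e) '' (I : Set S))).map φ.symm :=
    Ideal.mem_map_of_mem _ hmem
  rw [map_mul, map_pow, Ideal.map_span] at h1
  refine Ideal.span_mono ?_ h1
  rintro _ ⟨_, ⟨z, hz, rfl⟩, rfl⟩
  refine ⟨φ.symm z, ?_, ?_⟩
  · rw [SetLike.mem_coe, Ideal.mem_comap, RingEquiv.apply_symm_apply]
    exact hz
  · simp only [map_pow]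

/-- INVARIANCE: the crux's inline stalk clause — "`R` is a domain and every ideal generated by a system
of parameters (`d = dim R` elements generating an ideal with maximal radical) is tightly closed:
`c ≠ 0 ∧ (∀ e, c·y^(p^e) ∈ span {z^(p^e) | z ∈ (s)}) ⇒ y ∈ (s)`" — transports along a ring
isomorphism `φ : R ≃+* S`. -/
theorem stub_clause_of_ringEquiv (p : ℕ) {R S : Type} [CommRing R] [CommRing S] (φ : R ≃+* S)
    (h : IsDomain R ∧ ∀ d : ℕ, ringKrullDim R = d → ∀ s : Fin d → R,
      (Ideal.span (Set.range s)).radical.IsMaximal → ∀ y c : R, c ≠ 0 →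
      (∀ e : ℕ, c * y ^ p ^ e ∈ Ideal.span ((fun z : R => z ^ p ^ e) ''
        (Ideal.span (Set.range s) : Set R))) → y ∈ Ideal.span (Set.range s)) :
    IsDomain S ∧ ∀ d : ℕ, ringKrullDim S = d → ∀ s : Fin d → S,
      (Ideal.span (Set.range s)).radical.IsMaximal → ∀ y c : S, c ≠ 0 →
      (∀ e : ℕ, c * y ^ p ^ e ∈ Ideal.span ((fun z : S => z ^ p ^ e) ''
        (Ideal.span (Set.range s) : Set S))) → y ∈ Ideal.span (Set.range s) := by
  obtain ⟨hdom, htc⟩ := h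
  refine ⟨MulEquiv.isDomain R φ.symm.toMulEquiv, ?_⟩
  intro d hd s hmax y c hc hmem
  have hdR : ringKrullDim R = d := by rw [ringKrullDim_eq_of_ringEquiv φ, hd]
  have hI := span_range_symm_comp φ s
  have hmaxR : (Ideal.span (Set.range (φ.symm ∘ s))).radical.IsMaximal := by
    rw [hI, ← Ideal.comap_radical]
    exact Ideal.comap_isMaximal_of_equiv φ
  have hcR : φ.symm c ≠ 0 := φ.symm.map_ne_zero_iff.mpr hc
  have hmemR : ∀ e : ℕ, φ.symm c * φ.symm y ^ p ^ e ∈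
      Ideal.span ((fun z : R => z ^ p ^ e) '' (Ideal.span (Set.range (φ.symm ∘ s)) : Set R)) := by
    intro e
    rw [hI]
    exact symm_mem_span_pow_image φ p e _ (hmem e)
  have hy := htc d hdR (φ.symm ∘ s) hmaxR (φ.symm y) (φ.symm c) hcR hmemR
  rwa [hI, Ideal.mem_comap, RingEquiv.apply_symm_apply] at hy

end Summit.ResolutionOfSingularities.ResolutionOfSingularities.Theorems.FRationalResolution.ClauseInvariance
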